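import Literature.Topology.FourManifolds.UnitBallDiffeotopyReduction
import Literature.Topology.FourManifolds.UnorientedDiscTheoremDiffeotopy
import Mathlib.Analysis.SpecialFunctions.SmoothTransition
import HarnessLib

/-!
# Cerf's `π₀(Diff(D³; S²)) = 0`: reduction to centre-flat diffeomorphisms; the blow-up diffeotopy

Topic `Literature/Topology/FourManifolds`; fact seat (approach B) of the named fact
`Literature.Topology.FourManifolds.cerf_pi0DiffDisc_relBoundary_three` (`CerfPropositionFour.lean`:
Cerf 1968, Ch. I §2, statement (2), `π₀(Diff(D³; S²)) = 0`, in the model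
`UnitBallDiffeotopyTrivial ℝ³` of Cerf's group `𝒦` = diffeomorphisms of `ℝⁿ` equal to the
identity off the unit ball, smooth paths = `Literature.Topology.FourManifolds.Diffeotopy`).
**Everything in this file is proved; no definitions and no named facts are introduced.**

The one-parameter proofs of (2) — Cerf's own (Ch. I §2–3: (2) `⇔ π₀(𝒢) = 0 ⇔` Théorème 1′
`⇔` Théorème 1″, a section of the covering "3-discs with an isotopy class of parametrisations
`→` 2-spheres of `ℝ³`", then Ch. II–VI) and Hatcher's (Ann. of Math. 117 (1983): families of
smooth 2-spheres in `ℝ³` bound families of balls) — both act on the **loop of 2-spheres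
`t ↦ s(S²_r)/r`, `r = r(t) ∈ (0, 1]`, swept out by an element `s ∈ 𝒦`**, which is the
restriction to the unit sphere of the *blow-up path* `x ↦ s(r x)/r` from the linear map `Ds(0)`
(`r → 0`) to `s` (`r = 1`): Milnor's isotopy (Milnor, *Topology from the Differentiable
Viewpoint* (1965), §6, Lemma 2: "any orientation preserving diffeomorphism `f` of `Rᵐ` is
smoothly isotopic to the identity", proof: `F(x, t) = f(tx)/t`), equivalently the fibration of
embedded discs by their `1`-jet at the centre in Cerf's Appendice, §5, Prop. 3. This file
provides the two elementary normalisations that make this loop a genuine smooth loop based at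
the round sphere, in the tree's language, for every dimension `n`:

* §1 `exists_diffeotopy_blowUp`, `Diffeomorph.isDiffeotopicToId_of_forall_norm_le` — **the
  blow-up diffeotopy**: a diffeomorphism `s` of a real normed space which is the identity on a
  ball `B̄(0, δ)`, `δ > 0`, is the time-one stage of the diffeotopy with stages
  `x ↦ r(t)⁻¹ • s (r(t) • x)` (`r = Real.smoothTransition`; the stages are the identity for
  `t ≤ 0`, and near every point of `{r(t) = 0}` the family is *locally eventually the identity*,
  which is what makes Milnor's `F(x, t) = f(tx)/t` jointly smooth without computing `Df(0)`);
  in particular `s` is diffeotopic to the identity in `Diff` (no support condition: the supports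
  of the stages grow like `r(t)⁻¹`).
* §2 `Diffeomorph.det_fderiv_pos_of_forall_le_norm` — a diffeomorphism of a finite-dimensional
  space equal to the identity off a bounded set has everywhere positive Jacobian determinant.
* §3 `exists_isCompactlyDiffeotopicToIdIn_centreFlat` — **centre normalisation in `𝒦`**: for a
  compactly supported diffeomorphism `s` of `ℝⁿ` there are `P`, `H`, compactly diffeotopic to the
  identity, with `H⁻¹ ∘ P ∘ s` the identity near `0` (point push of `s 0` to `0`,
  `Diffeomorph.exists_isCompactlyDiffeotopicToIdIn_apply_eq`, then Hirsch's local straightening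
  with its diffeotopy, `exists_isCompactlyDiffeotopicToIdIn_apply_disc_eq_local_of_det_pos`, the
  Jacobian sign being supplied by §2); hence (`Diffeomorph.isDiffeotopicToId_of_forall_le_norm`)
  **every compactly supported diffeomorphism of `ℝⁿ` is diffeotopic to the identity in
  `Diff ℝⁿ`** — Milnor's Lemma 2 for the group `𝒦` — by §1.
* §4 `compactDiffeotopyTrivial_iff_centreFlat`, `unitBallDiffeotopyTrivial_iff_centreFlat`,
  `cerf_pi0DiffDisc_relBoundary_three_iff_centreFlat` — **(2) is equivalent to its restriction
  to the elements of `𝒦` that are the identity near the centre** (those for which the loop of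
  spheres `s(S²_r)/r` is constant near both ends), in the radius-free form
  `CompactDiffeotopyTrivial`, in the unit-ball form, and for the named fact (`n = 3`).

## References

* J. Cerf, *Sur les difféomorphismes de la sphère de dimension trois (Γ₄ = 0)*, Lecture Notes in
  Mathematics 53, Springer (1968), Ch. I §2 ((2), (3), Théorème 1′), §3 (Théorème 1″);
  Appendice §5, Proposition 3 (embeddings of `Dᵖ` and `p`-frames: the `1`-jet at the origin).
  [CerfDiffeoSphere1968]
* J. Milnor, *Topology from the Differentiable Viewpoint* (1965), §6, Lemma 2 (p. 34).
  [MilnorTDV1965]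
* M. W. Hirsch, *Differential Topology*, GTM 33 (1976), Ch. 8 §1 (Thms. 1.3–1.4), §3 (Thm. 3.1).
  [HirschDT1976]
* A. Hatcher, *A proof of the Smale conjecture, `Diff(S³) ≃ O(4)`*, Ann. of Math. 117 (1983)
  553–607.
-/

open scoped Manifold ContDiff Topology
open Function Set Metric Module

noncomputable section

namespace Literature.Topology.FourManifolds

/-! ## §1 The blow-up diffeotopy of a diffeomorphism which is the identity near the origin -/

section BlowUp

variable {E : Type*} [NormedAddCommGroup E] [NormedSpace ℝ E]

/-- The blow-up family `F_t x = x + r(t)⁻¹ • (f (r(t) • x) - r(t) • x)` of a smooth map `f`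
which is the identity on `B̄(0, δ)`, `δ > 0`, is jointly smooth on `ℝ × E`: where `r(t) ≠ 0`
it is `x ↦ r(t)⁻¹ • f (r(t) • x)` read through smooth operations, and near a point `(t₀, x₀)`
with `r(t₀) = 0` it coincides with `(t, x) ↦ x`, because `‖r(t) • x‖ ≤ δ` there
(Milnor (1965), §6, proof of Lemma 2, `F(x, t) = f(tx)/t`). [cite: MilnorTDV1965, §6, Lemma 2] -/
theorem contDiff_blowUpFamily {f : E → E} (hf : ContDiff ℝ ∞ f) {δ : ℝ} (hδ : 0 < δ)
    (hfδ : ∀ y, ‖y‖ ≤ δ → f y = y) :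
    ContDiff ℝ ∞ fun p : ℝ × E =>
      p.2 + (Real.smoothTransition p.1)⁻¹ • (f (Real.smoothTransition p.1 • p.2) -
        Real.smoothTransition p.1 • p.2) := by
  rw [contDiff_iff_contDiffAt]
  rintro ⟨t₀, x₀⟩
  have hr : ContDiff ℝ ∞ fun p : ℝ × E => Real.smoothTransition p.1 :=
    Real.smoothTransition.contDiff.comp contDiff_fst
  have hsm : ContDiff ℝ ∞ fun p : ℝ × E => Real.smoothTransition p.1 • p.2 := hr.smul contDiff_snd
  by_cases h0 : Real.smoothTransition t₀ = 0
  · -- near `(t₀, x₀)` the family is the second projection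
    have hV : ∀ᶠ p : ℝ × E in 𝓝 (t₀, x₀),
        Real.smoothTransition p.1 * (‖x₀‖ + 1) < δ ∧ ‖p.2‖ < ‖x₀‖ + 1 := by
      have hc1 : Continuous fun p : ℝ × E => Real.smoothTransition p.1 * (‖x₀‖ + 1) :=
        (Real.smoothTransition.continuous.comp continuous_fst).mul continuous_const
      have hc2 : Continuous fun p : ℝ × E => ‖p.2‖ := continuous_norm.comp continuous_snd
      refine (hc1.continuousAt.eventually_lt continuousAt_const ?_).and
        (hc2.continuousAt.eventually_lt continuousAt_const ?_)
      · simpa [h0] using hδ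
      · simp
    refine contDiffAt_snd.congr_of_eventuallyEq ?_
    filter_upwards [hV] with p hp
    have hle : ‖Real.smoothTransition p.1 • p.2‖ ≤ δ := by
      rw [norm_smul, Real.norm_of_nonneg (Real.smoothTransition.nonneg _)]
      calc Real.smoothTransition p.1 * ‖p.2‖
          ≤ Real.smoothTransition p.1 * (‖x₀‖ + 1) :=
            mul_le_mul_of_nonneg_left hp.2.le (Real.smoothTransition.nonneg _)
        _ ≤ δ := hp.1.le
    simp [hfδ _ hle]
  · -- where `r(t) ≠ 0` all operations are smooth
    have hinv : ContDiffAt ℝ ∞ (fun p : ℝ × E => (Real.smoothTransition p.1)⁻¹) (t₀, x₀) :=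
      hr.contDiffAt.inv h0
    exact contDiffAt_snd.add (hinv.smul ((hf.contDiffAt.comp _ hsm.contDiffAt).sub
      hsm.contDiffAt))

/-- Pointwise form of the blow-up family where `r(t) = c ≠ 0`:
`x + c⁻¹ • (f (c • x) - c • x) = c⁻¹ • f (c • x)`. [folklore] -/
theorem blowUpFamily_eq_of_ne_zero (f : E → E) {c : ℝ} (hc : c ≠ 0) (x : E) :
    x + c⁻¹ • (f (c • x) - c • x) = c⁻¹ • f (c • x) := by
  rw [smul_sub, inv_smul_smul₀ hc]
  abel

/-- **The blow-up diffeotopy** (Milnor (1965), §6, Lemma 2, for a diffeomorphism already equal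
to the identity near the origin). Let `s` be a diffeomorphism of a real normed space with
`s y = y` for `‖y‖ ≤ δ`, `δ > 0`. There is a diffeotopy of `E` with time-one stage `s` whose
stage at time `t` is `x ↦ r(t)⁻¹ • s (r(t) • x)` whenever `r(t) ≠ 0` and the identity whenever
`r(t) = 0`, `r = Real.smoothTransition` (so the stages are the identity for `t ≤ 0` and equal to
`s` for `t ≥ 1`). The stage at time `t` is the conjugate of `s` by the homothety of ratio
`r(t)`; restricted to the unit sphere (for `E = ℝ³`) it is the loop of embedded `2`-spheres
`s(S²_{r}) / r` on which Cerf's Théorème 1′/1″ and Hatcher's theorem operate.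
[cite: MilnorTDV1965, §6, Lemma 2] [cite: CerfDiffeoSphere1968, Appendice §5, Prop. 3] -/
theorem exists_diffeotopy_blowUp (s : E ≃ₘ⟮𝓘(ℝ, E), 𝓘(ℝ, E)⟯ E) {δ : ℝ} (hδ : 0 < δ)
    (hs : ∀ y, ‖y‖ ≤ δ → s y = y) :
    ∃ D : Diffeotopy 𝓘(ℝ, E) E, D.stage 1 = s ∧
      (∀ t x, Real.smoothTransition t ≠ 0 →
        D.toFun t x = (Real.smoothTransition t)⁻¹ • s (Real.smoothTransition t • x)) ∧
      (∀ t x, Real.smoothTransition t = 0 → D.toFun t x = x) := by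
  -- the inverse is the identity on the same ball
  have hs' : ∀ y, ‖y‖ ≤ δ → s.symm y = y := fun y hy => by
    conv_lhs => rw [← hs y hy]
    exact s.symm_apply_apply y
  have hsc : ContDiff ℝ ∞ (s : E → E) := contMDiff_iff_contDiff.mp s.contMDiff
  have hsc' : ContDiff ℝ ∞ (s.symm : E → E) := contMDiff_iff_contDiff.mp s.symm.contMDiff
  set r : ℝ → ℝ := Real.smoothTransition with hr
  set F : ℝ → E → E := fun t x => x + (r t)⁻¹ • (s (r t • x) - r t • x) with hF
  set G : ℝ → E → E := fun t y => y + (r t)⁻¹ • (s.symm (r t • y) - r t • y) with hG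
  have hFc : ContMDiff (𝓘(ℝ, ℝ).prod 𝓘(ℝ, E)) 𝓘(ℝ, E) ∞ (uncurry F) :=
    contMDiff_prod_self_of_contDiff (contDiff_blowUpFamily hsc hδ hs)
  have hGc : ContMDiff (𝓘(ℝ, ℝ).prod 𝓘(ℝ, E)) 𝓘(ℝ, E) ∞ (uncurry G) :=
    contMDiff_prod_self_of_contDiff (contDiff_blowUpFamily hsc' hδ hs')
  have hF0 : ∀ t x, r t = 0 → F t x = x := fun t x ht => by simp [hF, ht]
  have hG0 : ∀ t y, r t = 0 → G t y = y := fun t y ht => by simp [hG, ht]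
  have hF1 : ∀ t x, r t ≠ 0 → F t x = (r t)⁻¹ • s (r t • x) := fun t x ht =>
    blowUpFamily_eq_of_ne_zero s ht x
  have hG1 : ∀ t y, r t ≠ 0 → G t y = (r t)⁻¹ • s.symm (r t • y) := fun t y ht =>
    blowUpFamily_eq_of_ne_zero s.symm ht y
  have hGF : ∀ t x, G t (F t x) = x := fun t x => by
    by_cases ht : r t = 0
    · rw [hF0 t x ht, hG0 t x ht]
    · rw [hF1 t x ht, hG1 t _ ht, smul_inv_smul₀ ht, s.symm_apply_apply, inv_smul_smul₀ ht]
  have hFG : ∀ t y, F t (G t y) = y := fun t y => by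
    by_cases ht : r t = 0
    · rw [hG0 t y ht, hF0 t y ht]
    · rw [hG1 t y ht, hF1 t _ ht, smul_inv_smul₀ ht, s.apply_symm_apply, inv_smul_smul₀ ht]
  have h00 : F 0 = id := by
    funext x
    exact hF0 0 x (Real.smoothTransition.zero_of_nonpos le_rfl)
  refine ⟨Diffeotopy.mk' 𝓘(ℝ, E) F G hFc hGc hGF hFG h00, ?_, fun t x ht => ?_, fun t x ht => ?_⟩
  · ext x
    rw [Diffeotopy.coe_stage, Diffeotopy.mk'_toFun,
      hF1 1 x (by rw [hr, Real.smoothTransition.one_of_one_le le_rfl]; exact one_ne_zero)]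
    simp [hr, Real.smoothTransition.one_of_one_le le_rfl]
  · rw [Diffeotopy.mk'_toFun]; exact hF1 t x ht
  · rw [Diffeotopy.mk'_toFun]; exact hF0 t x ht

/-- **A diffeomorphism of a real normed space which is the identity near the origin is
diffeotopic to the identity** (by the blow-up diffeotopy `exists_diffeotopy_blowUp`; Milnor
(1965), §6, Lemma 2). No hypothesis on the support: the supports of the stages grow like
`r(t)⁻¹` as `t → 0`. [cite: MilnorTDV1965, §6, Lemma 2] -/
theorem Diffeomorph.isDiffeotopicToId_of_forall_norm_le (s : E ≃ₘ⟮𝓘(ℝ, E), 𝓘(ℝ, E)⟯ E)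
    {δ : ℝ} (hδ : 0 < δ) (hs : ∀ y, ‖y‖ ≤ δ → s y = y) : Diffeomorph.IsDiffeotopicToId s := by
  obtain ⟨D, hD, -, -⟩ := exists_diffeotopy_blowUp s hδ hs
  exact ⟨D, hD⟩

end BlowUp

/-! ## §2 The Jacobian of a diffeomorphism which is the identity far away is positive -/

section Jacobian

variable {E : Type*} [NormedAddCommGroup E] [NormedSpace ℝ E] [FiniteDimensional ℝ E]

/-- The differential of a diffeomorphism of a finite-dimensional space has nonzero determinant
(it has the differential of the inverse as a left inverse). [folklore] -/
theorem Diffeomorph.det_fderiv_ne_zero (φ : E ≃ₘ⟮𝓘(ℝ, E), 𝓘(ℝ, E)⟯ E) (x : E) :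
    LinearMap.det (fderiv ℝ φ x : E →ₗ[ℝ] E) ≠ 0 := by
  have hinj : Injective (fderiv ℝ φ x) := by
    intro v w hvw
    have h := congrArg (fderiv ℝ φ.symm (φ x)) hvw
    rw [← ContinuousLinearMap.comp_apply, ← ContinuousLinearMap.comp_apply,
      Diffeomorph.fderiv_symm_comp_fderiv φ x] at h
    simpa using h
  have hunit : IsUnit (fderiv ℝ φ x : E →ₗ[ℝ] E) :=
    (LinearMap.isUnit_iff_ker_eq_bot _).2 (LinearMap.ker_eq_bot.2 hinj)
  exact ((LinearMap.isUnit_iff_isUnit_det _).1 hunit).ne_zero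

/-- **A diffeomorphism of a finite-dimensional real normed space which is the identity off a
bounded set has everywhere positive Jacobian determinant**: `y ↦ det Dφ(y)` is continuous,
never zero, and equals `1` at a point far away, so it is positive by the intermediate value
theorem on the connected space `E`. [folklore] -/
theorem Diffeomorph.det_fderiv_pos_of_forall_le_norm (φ : E ≃ₘ⟮𝓘(ℝ, E), 𝓘(ℝ, E)⟯ E) {R : ℝ}
    (hφ : ∀ y, R ≤ ‖y‖ → φ y = y) (x : E) :
    0 < LinearMap.det (fderiv ℝ φ x : E →ₗ[ℝ] E) := by
  have hφc : ContDiff ℝ ∞ (φ : E → E) := contMDiff_iff_contDiff.mp φ.contMDiff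
  have hcont : Continuous fun y => LinearMap.det (fderiv ℝ φ y : E →ₗ[ℝ] E) :=
    ContinuousLinearMap.continuous_det.comp (hφc.continuous_fderiv (by simp))
  -- a far point where `φ` is the identity near it
  rcases subsingleton_or_nontrivial E with hE | hE
  · have : (fderiv ℝ φ x : E →ₗ[ℝ] E) = LinearMap.id := Subsingleton.elim _ _
    rw [this, LinearMap.det_id]
    exact one_pos
  obtain ⟨v, hv⟩ := exists_ne (0 : E)
  set x₀ : E := ((|R| + 1) / ‖v‖) • v with hx₀
  have hvn : 0 < ‖v‖ := norm_pos_iff.2 hv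
  have hx₀n : ‖x₀‖ = |R| + 1 := by
    rw [hx₀, norm_smul, Real.norm_of_nonneg (by positivity), div_mul_cancel₀ _ hvn.ne']
  have hfar : (φ : E → E) =ᶠ[𝓝 x₀] id := by
    have hopen : IsOpen {y : E | R < ‖y‖} := isOpen_lt continuous_const continuous_norm
    have hmem : x₀ ∈ {y : E | R < ‖y‖} := by
      show R < ‖x₀‖
      rw [hx₀n]
      linarith [le_abs_self R]
    filter_upwards [hopen.mem_nhds hmem] with y hy
    exact hφ y (le_of_lt hy)
  have hx₀d : LinearMap.det (fderiv ℝ φ x₀ : E →ₗ[ℝ] E) = 1 := by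
    rw [hfar.fderiv_eq, fderiv_id]
    exact LinearMap.det_id
  by_contra hx
  push Not at hx
  obtain ⟨z, hz⟩ := intermediate_value_univ x x₀ hcont ⟨hx, by rw [hx₀d]; exact zero_le_one⟩
  exact Diffeomorph.det_fderiv_ne_zero φ z hz

end Jacobian

/-! ## §3 Centre normalisation in Cerf's group `𝒦` -/

section CentreFlat

variable {n : ℕ}

-- No local notation in this pure-theorems file: the model space `ℝⁿ` is written out as
-- `EuclideanSpace ℝ (Fin n)`.

/-- A diffeomorphism of `ℝⁿ` compactly diffeotopic to the identity (inside `univ`) is the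
identity off some ball, and so are all the stages of the diffeotopy. [folklore] -/
theorem Diffeomorph.IsCompactlyDiffeotopicToIdIn.exists_compactDiffeotopy
    {P : EuclideanSpace ℝ (Fin n) ≃ₘ⟮𝓡 n, 𝓡 n⟯ EuclideanSpace ℝ (Fin n)}
    (hP : Diffeomorph.IsCompactlyDiffeotopicToIdIn univ P) :
    ∃ D : Diffeotopy (𝓡 n) (EuclideanSpace ℝ (Fin n)), D.stage 1 = P ∧
      ∃ R : ℝ, ∀ t y, R ≤ ‖y‖ → D.toFun t y = y := by
  obtain ⟨D, K, hK, -, h1, hDK⟩ := hP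
  obtain ⟨R, -, hKR⟩ := hK.isBounded.subset_ball_lt 0 (0 : EuclideanSpace ℝ (Fin n))
  refine ⟨D, h1, R, fun t y hy => hDK t y fun hyK => ?_⟩
  have := hKR hyK
  rw [mem_ball_zero_iff] at this
  exact absurd hy (not_le.2 this)

/-- A diffeomorphism of `ℝⁿ` compactly diffeotopic to the identity is the identity off some
ball. [folklore] -/
theorem Diffeomorph.IsCompactlyDiffeotopicToIdIn.exists_forall_le_norm
    {P : EuclideanSpace ℝ (Fin n) ≃ₘ⟮𝓡 n, 𝓡 n⟯ EuclideanSpace ℝ (Fin n)}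
    (hP : Diffeomorph.IsCompactlyDiffeotopicToIdIn univ P) :
    ∃ R : ℝ, ∀ y, R ≤ ‖y‖ → P y = y := by
  obtain ⟨D, h1, R, hD⟩ := hP.exists_compactDiffeotopy
  refine ⟨R, fun y hy => ?_⟩
  rw [← h1, Diffeotopy.coe_stage]
  exact hD 1 y hy

/-- **Centre normalisation in `𝒦` (all dimensions).** Let `s` be a diffeomorphism of `ℝⁿ`
which is the identity off a bounded set. There are diffeomorphisms `P` and `H` of `ℝⁿ`, both
compactly diffeotopic to the identity, and `ρ > 0` with `H y = P (s y)` for `‖y‖ ≤ ρ`; that is,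
`H⁻¹ ∘ P ∘ s` is the identity on `B̄(0, ρ)`. Proof: push `s 0` back to `0` by `P` (homogeneity
with a compactly supported diffeotopy, Hirsch (1976), Ch. 8 §3, Thm. 3.1, `k = 0`), then
straighten the germ of `P ∘ s` at `0`, whose Jacobian is positive
(`Diffeomorph.det_fderiv_pos_of_forall_le_norm`), by Hirsch's local disc theorem with its
diffeotopy (`exists_isCompactlyDiffeotopicToIdIn_apply_disc_eq_local_of_det_pos`, in the
identity chart of `ℝⁿ`). This is the normalisation of the `1`-jet at the centre of Cerf's
Appendice, §5, proof of Prop. 3, inside the group `𝒦`.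
[cite: HirschDT1976, Ch. 8 §3, Thm. 3.1; Ch. 8 §1, Thms. 1.3–1.4]
[cite: CerfDiffeoSphere1968, Appendice §5, Prop. 3] -/
theorem exists_isCompactlyDiffeotopicToIdIn_centreFlat
    (s : EuclideanSpace ℝ (Fin n) ≃ₘ⟮𝓡 n, 𝓡 n⟯ EuclideanSpace ℝ (Fin n)) {R : ℝ}
    (hs : ∀ y, R ≤ ‖y‖ → s y = y) :
    ∃ P H : EuclideanSpace ℝ (Fin n) ≃ₘ⟮𝓡 n, 𝓡 n⟯ EuclideanSpace ℝ (Fin n),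
      Diffeomorph.IsCompactlyDiffeotopicToIdIn univ P ∧
      Diffeomorph.IsCompactlyDiffeotopicToIdIn univ H ∧
      ∃ ρ > (0 : ℝ), ∀ y : EuclideanSpace ℝ (Fin n), ‖y‖ ≤ ρ → H y = P (s y) := by
  -- Step 1: point push of `s 0` to `0`
  obtain ⟨P, hP, hP0⟩ := Diffeomorph.exists_isCompactlyDiffeotopicToIdIn_apply_eq (n := n)
    (M := EuclideanSpace ℝ (Fin n)) isOpen_univ isPreconnected_univ (mem_univ (s 0))
    (mem_univ (0 : EuclideanSpace ℝ (Fin n)))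
  -- the diffeomorphism `k = P ∘ s` fixes `0` and is the identity far away
  set k : EuclideanSpace ℝ (Fin n) ≃ₘ⟮𝓡 n, 𝓡 n⟯ EuclideanSpace ℝ (Fin n) := s.trans P with hk
  obtain ⟨R', hPR'⟩ := hP.exists_forall_le_norm
  have hkfar : ∀ y, max R R' ≤ ‖y‖ → k y = y := fun y hy => by
    rw [hk, Diffeomorph.coe_trans, comp_apply, hs y ((le_max_left _ _).trans hy),
      hPR' y ((le_max_right _ _).trans hy)]
  have hkemb : Manifold.IsSmoothEmbedding 𝓘(ℝ, EuclideanSpace ℝ (Fin n)) (𝓡 n) ∞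
      (k : EuclideanSpace ℝ (Fin n) → EuclideanSpace ℝ (Fin n)) :=
    k.isSmoothEmbedding'
  have hk0 : (k : EuclideanSpace ℝ (Fin n) → EuclideanSpace ℝ (Fin n)) 0 =
      id (0 : EuclideanSpace ℝ (Fin n)) := by
    rw [hk, Diffeomorph.coe_trans, comp_apply, hP0, id]
  -- Step 2: local straightening at `0` in the identity chart
  set Φ : OpenPartialHomeomorph (EuclideanSpace ℝ (Fin n)) (EuclideanSpace ℝ (Fin n)) :=
    OpenPartialHomeomorph.refl (EuclideanSpace ℝ (Fin n)) with hΦ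
  have hΦt : Φ.target = univ := rfl
  have hΦs : ⇑Φ.symm = id := rfl
  have hΦsrc : Φ.source = range (id : EuclideanSpace ℝ (Fin n) → EuclideanSpace ℝ (Fin n)) := by
    rw [range_id]; rfl
  have hΦc : ContMDiffOn (𝓡 n) (𝓡 n) ∞ Φ Φ.source := contMDiff_id.contMDiffOn
  have hΦ' : ContMDiff (𝓡 n) (𝓡 n) ∞ Φ.symm := contMDiff_id
  have hpos : 0 < LinearMap.det ((fderiv ℝ
      (Φ ∘ (k : EuclideanSpace ℝ (Fin n) → EuclideanSpace ℝ (Fin n))) 0 :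
        EuclideanSpace ℝ (Fin n) →L[ℝ] EuclideanSpace ℝ (Fin n)) :
      EuclideanSpace ℝ (Fin n) →ₗ[ℝ] EuclideanSpace ℝ (Fin n)) := by
    have : (Φ : EuclideanSpace ℝ (Fin n) → EuclideanSpace ℝ (Fin n)) ∘
        (k : EuclideanSpace ℝ (Fin n) → EuclideanSpace ℝ (Fin n)) = k := rfl
    rw [this]
    exact Diffeomorph.det_fderiv_pos_of_forall_le_norm k hkfar 0
  obtain ⟨H, hH, ρ, hρ, hHk⟩ :=
    exists_isCompactlyDiffeotopicToIdIn_apply_disc_eq_local_of_det_pos (n := n)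
      (M := EuclideanSpace ℝ (Fin n)) hkemb hk0 hΦt hΦs hΦsrc hΦc hΦ' hpos (subset_univ _)
  refine ⟨P, H, hP, hH, ρ, hρ, fun y hy => ?_⟩
  have := hHk y hy
  rwa [hk, Diffeomorph.coe_trans, comp_apply] at this

/-- **Milnor's Lemma 2 for Cerf's group `𝒦`: every compactly supported diffeomorphism of `ℝⁿ`
is diffeotopic to the identity in `Diff ℝⁿ`** (Milnor (1965), §6, Lemma 2, "any orientation
preserving diffeomorphism of `Rᵐ` is smoothly isotopic to the identity", for the diffeomorphisms
equal to the identity off a bounded set, which are orientation preserving by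
`Diffeomorph.det_fderiv_pos_of_forall_le_norm`): write `s = P⁻¹ ∘ H ∘ s₂` with `P`, `H`
compactly diffeotopic to the identity and `s₂` the identity near `0`
(`exists_isCompactlyDiffeotopicToIdIn_centreFlat`), and apply the blow-up diffeotopy to `s₂`
(`Diffeomorph.isDiffeotopicToId_of_forall_norm_le`). The diffeotopy is NOT supported in a
bounded set in general — that statement is `π₀(𝒦ₙ) = 0`, false for `n = 6` and for `n = 3` the
named fact `cerf_pi0DiffDisc_relBoundary_three`. [cite: MilnorTDV1965, §6, Lemma 2] -/
theorem Diffeomorph.isDiffeotopicToId_of_forall_le_norm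
    (s : EuclideanSpace ℝ (Fin n) ≃ₘ⟮𝓡 n, 𝓡 n⟯ EuclideanSpace ℝ (Fin n)) {R : ℝ}
    (hs : ∀ y, R ≤ ‖y‖ → s y = y) : Diffeomorph.IsDiffeotopicToId s := by
  obtain ⟨P, H, hP, hH, ρ, hρ, hHPs⟩ := exists_isCompactlyDiffeotopicToIdIn_centreFlat s hs
  set s₂ : EuclideanSpace ℝ (Fin n) ≃ₘ⟮𝓡 n, 𝓡 n⟯ EuclideanSpace ℝ (Fin n) :=
    (s.trans P).trans H.symm with hs₂
  have hs₂ρ : ∀ y, ‖y‖ ≤ ρ → s₂ y = y := fun y hy => by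
    simp only [hs₂, Diffeomorph.coe_trans, comp_apply]
    rw [← hHPs y hy, H.symm_apply_apply]
  have h₂ : Diffeomorph.IsDiffeotopicToId s₂ :=
    Diffeomorph.isDiffeotopicToId_of_forall_norm_le s₂ hρ hs₂ρ
  have hfact : s = (s₂.trans H).trans P.symm := by
    ext y
    simp [hs₂]
  rw [hfact]
  exact (h₂.trans hH.isDiffeotopicToId).trans hP.isDiffeotopicToId.symm

/-! ## §4 The reduction of `π₀(𝒦) = 0` to centre-flat diffeomorphisms -/

/-- **Radius-free form.** `π₀` of the compactly supported diffeomorphisms of `ℝⁿ` is trivial as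
soon as every compactly supported diffeomorphism *which is the identity near `0`* is reached by
a compactly supported diffeotopy: for a general `s` write `s = P⁻¹ ∘ H ∘ s₂` as in
`exists_isCompactlyDiffeotopicToIdIn_centreFlat` (`s₂` centre-flat and compactly supported,
`P`, `H` reached by compactly supported diffeotopies) and compose stagewise
(`exists_compactDiffeotopy_trans`, `exists_compactDiffeotopy_symm`).
[cite: CerfDiffeoSphere1968, Ch. I §2, (2); Appendice §5, Prop. 3] -/
theorem compactDiffeotopyTrivial_of_centreFlat
    (h : ∀ (s : EuclideanSpace ℝ (Fin n) ≃ₘ⟮𝓡 n, 𝓡 n⟯ EuclideanSpace ℝ (Fin n)) (R : ℝ),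
      (∀ y, R ≤ ‖y‖ → s y = y) → (∃ ρ > (0 : ℝ), ∀ y, ‖y‖ ≤ ρ → s y = y) →
      ∃ D : Diffeotopy (𝓡 n) (EuclideanSpace ℝ (Fin n)), D.stage 1 = s ∧
        ∃ R' : ℝ, ∀ t y, R' ≤ ‖y‖ → D.toFun t y = y) :
    CompactDiffeotopyTrivial (EuclideanSpace ℝ (Fin n)) := by
  intro s R hs
  obtain ⟨P, H, hP, hH, ρ, hρ, hHPs⟩ := exists_isCompactlyDiffeotopicToIdIn_centreFlat s hs
  obtain ⟨RP, hPR⟩ := hP.exists_forall_le_norm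
  obtain ⟨RH, hHR⟩ := hH.exists_forall_le_norm
  set s₂ : EuclideanSpace ℝ (Fin n) ≃ₘ⟮𝓡 n, 𝓡 n⟯ EuclideanSpace ℝ (Fin n) :=
    (s.trans P).trans H.symm with hs₂
  have hs₂ρ : ∀ y, ‖y‖ ≤ ρ → s₂ y = y := fun y hy => by
    simp only [hs₂, Diffeomorph.coe_trans, comp_apply]
    rw [← hHPs y hy, H.symm_apply_apply]
  have hs₂far : ∀ y, max R (max RP RH) ≤ ‖y‖ → s₂ y = y := fun y hy => by
    have hRy : R ≤ ‖y‖ := (le_max_left _ _).trans hy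
    have hPy : RP ≤ ‖y‖ := ((le_max_left _ _).trans (le_max_right _ _)).trans hy
    have hHy : RH ≤ ‖y‖ := ((le_max_right _ _).trans (le_max_right _ _)).trans hy
    simp only [hs₂, Diffeomorph.coe_trans, comp_apply]
    rw [hs y hRy, hPR y hPy]
    conv_lhs => rw [← hHR y hHy]
    exact H.symm_apply_apply y
  have h₂ := h s₂ _ hs₂far ⟨ρ, hρ, hs₂ρ⟩
  have hfact : s = (s₂.trans H).trans P.symm := by
    ext y
    simp [hs₂]
  rw [hfact]
  exact exists_compactDiffeotopy_trans
    (exists_compactDiffeotopy_trans h₂ hH.exists_compactDiffeotopy)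
    (exists_compactDiffeotopy_symm hP.exists_compactDiffeotopy)

/-- **`π₀(𝒦ₙ) = 0` in radius-free form is equivalent to its restriction to centre-flat
diffeomorphisms.** [cite: CerfDiffeoSphere1968, Ch. I §2, (2); Appendice §5, Prop. 3] -/
theorem compactDiffeotopyTrivial_iff_centreFlat :
    CompactDiffeotopyTrivial (EuclideanSpace ℝ (Fin n)) ↔
      ∀ (s : EuclideanSpace ℝ (Fin n) ≃ₘ⟮𝓡 n, 𝓡 n⟯ EuclideanSpace ℝ (Fin n)) (R : ℝ),
        (∀ y, R ≤ ‖y‖ → s y = y) → (∃ ρ > (0 : ℝ), ∀ y, ‖y‖ ≤ ρ → s y = y) →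
        ∃ D : Diffeotopy (𝓡 n) (EuclideanSpace ℝ (Fin n)), D.stage 1 = s ∧
          ∃ R' : ℝ, ∀ t y, R' ≤ ‖y‖ → D.toFun t y = y :=
  ⟨fun h s R hs _ => h s R hs, compactDiffeotopyTrivial_of_centreFlat⟩

/-- **Unit-ball form.** `π₀(𝒦ₙ) = 0` (`UnitBallDiffeotopyTrivial ℝⁿ`: every diffeomorphism of
`ℝⁿ` equal to the identity on `{‖y‖ ≥ 1}` is reached by a diffeotopy through such
diffeomorphisms) already follows from its restriction to the diffeomorphisms which are moreover
the identity near `0`: pass to the radius-free form (`UnitBallDiffeotopyTrivial.of_compact`),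
reduce there (`compactDiffeotopyTrivial_of_centreFlat`), and come back by conjugating with a
homothety, which preserves centre-flatness (as in `CompactDiffeotopyTrivial.of_unitBall`).
[cite: CerfDiffeoSphere1968, Ch. I §2, (2); Appendice §5, Prop. 3] -/
theorem unitBallDiffeotopyTrivial_of_centreFlat
    (h : ∀ s : EuclideanSpace ℝ (Fin n) ≃ₘ⟮𝓡 n, 𝓡 n⟯ EuclideanSpace ℝ (Fin n),
      (∀ y, 1 ≤ ‖y‖ → s y = y) → (∃ ρ > (0 : ℝ), ∀ y, ‖y‖ ≤ ρ → s y = y) →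
      ∃ D : Diffeotopy (𝓡 n) (EuclideanSpace ℝ (Fin n)), D.stage 1 = s ∧
        ∀ t y, 1 ≤ ‖y‖ → D.toFun t y = y) :
    UnitBallDiffeotopyTrivial (EuclideanSpace ℝ (Fin n)) := by
  refine UnitBallDiffeotopyTrivial.of_compact (compactDiffeotopyTrivial_of_centreFlat ?_)
  rintro s R hs ⟨ρ, hρ, hsρ⟩
  -- enlarge the radius to a positive one
  set R₁ : ℝ := max R 1 with hR₁
  have hR₁0 : 0 < R₁ := lt_of_lt_of_le one_pos (le_max_right _ _)
  have hs₁ : ∀ y, R₁ ≤ ‖y‖ → s y = y := fun y hy => hs y ((le_max_left _ _).trans hy)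
  -- `s' := δ⁻¹ ∘ s ∘ δ`, `δ = R₁ •`, is supported in the unit ball and still centre-flat
  set δ := homothetyDiffeomorph (E := EuclideanSpace ℝ (Fin n)) R₁ hR₁0.ne' with hδ
  set s' := δ.trans (s.trans δ.symm) with hs'
  have hs'₁ : ∀ y, 1 ≤ ‖y‖ → s' y = y := by
    intro y hy
    have hy' : R₁ ≤ ‖R₁ • y‖ := by
      rw [norm_smul, Real.norm_of_nonneg hR₁0.le]
      nlinarith
    simp only [hs', Diffeomorph.coe_trans, comp_apply, hδ, homothetyDiffeomorph_apply]
    rw [hs₁ _ hy', homothetyDiffeomorph_symm_apply, inv_smul_smul₀ hR₁0.ne']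
  have hs'ρ : ∃ ρ' > (0 : ℝ), ∀ y, ‖y‖ ≤ ρ' → s' y = y := by
    refine ⟨ρ / R₁, div_pos hρ hR₁0, fun y hy => ?_⟩
    have hy' : ‖R₁ • y‖ ≤ ρ := by
      rw [norm_smul, Real.norm_of_nonneg hR₁0.le]
      rwa [le_div_iff₀ hR₁0, mul_comm] at hy
    simp only [hs', Diffeomorph.coe_trans, comp_apply, hδ, homothetyDiffeomorph_apply]
    rw [hsρ _ hy', homothetyDiffeomorph_symm_apply, inv_smul_smul₀ hR₁0.ne']
  obtain ⟨D', hD'1, hD'⟩ := h s' hs'₁ hs'ρ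
  refine ⟨D'.pushforward δ, ?_, R₁, fun t y hy => ?_⟩
  · rw [Diffeotopy.pushforward_stage, hD'1, hs']
    ext y
    simp
  · have hy' : 1 ≤ ‖R₁⁻¹ • y‖ := by
      rw [norm_smul, norm_inv, Real.norm_of_nonneg hR₁0.le]
      rw [le_inv_mul_iff₀ hR₁0]
      simpa using hy
    simp only [Diffeotopy.pushforward_toFun, hδ, homothetyDiffeomorph_apply,
      homothetyDiffeomorph_symm_apply]
    rw [hD' t _ hy', smul_inv_smul₀ hR₁0.ne']

/-- **`π₀(𝒦ₙ) = 0` in unit-ball form is equivalent to its restriction to centre-flat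
diffeomorphisms** (those `s` for which the loop of spheres `s(Sⁿ⁻¹_r)/r`, `r ∈ (0, 1]`, is
constant near both ends). [cite: CerfDiffeoSphere1968, Ch. I §2, (2); Appendice §5, Prop. 3] -/
theorem unitBallDiffeotopyTrivial_iff_centreFlat :
    UnitBallDiffeotopyTrivial (EuclideanSpace ℝ (Fin n)) ↔
      ∀ s : EuclideanSpace ℝ (Fin n) ≃ₘ⟮𝓡 n, 𝓡 n⟯ EuclideanSpace ℝ (Fin n),
        (∀ y, 1 ≤ ‖y‖ → s y = y) → (∃ ρ > (0 : ℝ), ∀ y, ‖y‖ ≤ ρ → s y = y) →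
        ∃ D : Diffeotopy (𝓡 n) (EuclideanSpace ℝ (Fin n)), D.stage 1 = s ∧
          ∀ t y, 1 ≤ ‖y‖ → D.toFun t y = y :=
  ⟨fun h s hs _ => h s hs, unitBallDiffeotopyTrivial_of_centreFlat⟩

/-- **Cerf's (2) reduced to centre-flat diffeomorphisms.** The named fact
`cerf_pi0DiffDisc_relBoundary_three` (`π₀(Diff(D³; S²)) = 0`, Cerf (1968), Ch. I §2, (2)) is
equivalent to: every diffeomorphism of `ℝ³` which is the identity on `{‖y‖ ≥ 1}` **and on a
neighbourhood of `0`** is the time-one stage of a diffeotopy of `ℝ³` through diffeomorphisms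
equal to the identity on `{‖y‖ ≥ 1}`. For such `s` the blow-up path `x ↦ s(r x)/r`
(`exists_diffeotopy_blowUp`) sweeps out a smooth loop of embedded `2`-spheres `s(S²_r)/r` based
at the round sphere and constant near its ends — the object of Cerf's Théorème 1′/1″ (Ch. I
§2–3) and of Hatcher's theorem. [cite: CerfDiffeoSphere1968, Ch. I §2, (2) and Théorème 1′] -/
theorem cerf_pi0DiffDisc_relBoundary_three_iff_centreFlat :
    cerf_pi0DiffDisc_relBoundary_three ↔
      ∀ s : EuclideanSpace ℝ (Fin 3) ≃ₘ⟮𝓡 3, 𝓡 3⟯ EuclideanSpace ℝ (Fin 3),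
        (∀ y, 1 ≤ ‖y‖ → s y = y) → (∃ ρ > (0 : ℝ), ∀ y, ‖y‖ ≤ ρ → s y = y) →
        ∃ D : Diffeotopy (𝓡 3) (EuclideanSpace ℝ (Fin 3)), D.stage 1 = s ∧
          ∀ t y, 1 ≤ ‖y‖ → D.toFun t y = y :=
  cerf_pi0DiffDisc_relBoundary_three_iff.trans unitBallDiffeotopyTrivial_iff_centreFlat

/-- The direction by which a proof for centre-flat diffeomorphisms yields the named fact.
[cite: CerfDiffeoSphere1968, Ch. I §2, (2)] -/
theorem cerf_pi0DiffDisc_relBoundary_three_of_centreFlat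
    (h : ∀ s : EuclideanSpace ℝ (Fin 3) ≃ₘ⟮𝓡 3, 𝓡 3⟯ EuclideanSpace ℝ (Fin 3),
      (∀ y, 1 ≤ ‖y‖ → s y = y) → (∃ ρ > (0 : ℝ), ∀ y, ‖y‖ ≤ ρ → s y = y) →
      ∃ D : Diffeotopy (𝓡 3) (EuclideanSpace ℝ (Fin 3)), D.stage 1 = s ∧
        ∀ t y, 1 ≤ ‖y‖ → D.toFun t y = y) :
    cerf_pi0DiffDisc_relBoundary_three :=
  cerf_pi0DiffDisc_relBoundary_three_iff_centreFlat.2 h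

end CentreFlat

end Literature.Topology.FourManifolds

end
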